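import Summits.CriticalPhenomena.PercolationContinuityZ3.Theorems.PercNearOneGluingNoHeavyLowerTailAntitheticCherryOplus
import Summits.CriticalPhenomena.PercolationContinuityZ3.Theorems.PercNearOneGluingNoHeavyLowerTailAntitheticPairCubes
import HarnessLib

/-!
# `NoHeavyLowerTail` (stmt-CriticalPhenomena-4575) — antithetic cluster pairs: VECTOR-FORM pair-cube certificates (prim-hp-2 gen 58)

Support file (`--supports stmt-CriticalPhenomena-4575`, hull-port prover `prim-hp-2`, gen 58).  No definitions, no named facts, no sorries;
standard axioms.  The GENERIC half of the certificate format of …AntitheticCherryOplus, so that an instance file only has to state its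
data once: a finite family `D` of colourings with Finset-valued pair map `π`, three vectors of pieces — 1-cubes `(BOT i, TOP i)` with
weights `W1 i`, 0-cubes `PT0 j` with `W0 j`, 2-cubes `(QA m, QB m, QC m, QD m)` with `W2 m` (all `ℕ`) — a scale `L > 0`, the COVER
equation `L · #{a : π a = z} = Σ pieces at z` for every value `z` (as "no exception": a filter is empty, the form `native_decide`
handles well), membership of all piece points among the values, and the inclusion conditions (1-cube: `P ⊆ P', Q' ⊆ Q, Q' ⊆ P, Q ⊆ P'`;
0-cube: `Q ⊆ P`; 2-cube: the four edges and the two antipodal dominations).  Conclusion (`Antithetic.Cert.oplus_of_vector_cert`):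
`0 ≤ Σ_{a ∈ D} K₁ (π a).1 (π a).2 * K₂ (π a).1 (π a).2` for all twisted-monotone super-odd `K₁, K₂` — by `Cherry.one_cube_nonneg`,
`Cherry.zero_cube_nonneg`, `Cube.two_nonneg`.  Instance files: HOME/code/gen58/lab58/gen_oplus_lean.py.
[cite: VandenbergHaggstromKahn2005, §1 p. 6 ("Harris' inequality")]
-/

noncomputable section

namespace Summit.CriticalPhenomena.PercolationContinuityZ3.Theorems

namespace Antithetic

namespace Cert

variable {α : Type*} {V : Type*} [DecidableEq V]

/-- **Vector-form certificate theorem** (see the module docstring). [this work] -/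
theorem oplus_of_vector_cert (D : Finset α) (π : α → Finset V × Finset V) (L : ℕ) (hL : 0 < L) {k1 k0 k2 : ℕ}
    (BOT TOP : Fin k1 → Finset V × Finset V) (W1 : Fin k1 → ℕ) (PT0 : Fin k0 → Finset V × Finset V) (W0 : Fin k0 → ℕ)
    (QA QB QC QD : Fin k2 → Finset V × Finset V) (W2 : Fin k2 → ℕ)
    (hcover : (D.image π).filter (fun z => L * (D.filter fun a => π a = z).card ≠
      (∑ i : Fin k1, W1 i * ((if BOT i = z then 1 else 0) + (if TOP i = z then 1 else 0))) +
        (∑ j : Fin k0, W0 j * (if PT0 j = z then 1 else 0)) +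
        ∑ m : Fin k2, W2 m * ((if QA m = z then 1 else 0) + (if QB m = z then 1 else 0) + (if QC m = z then 1 else 0) +
          (if QD m = z then 1 else 0))) = ∅)
    (hmem : (∀ i : Fin k1, BOT i ∈ D.image π ∧ TOP i ∈ D.image π) ∧ (∀ j : Fin k0, PT0 j ∈ D.image π) ∧
      (∀ m : Fin k2, QA m ∈ D.image π ∧ QB m ∈ D.image π ∧ QC m ∈ D.image π ∧ QD m ∈ D.image π))
    (hok : (∀ i : Fin k1, (BOT i).1 ⊆ (TOP i).1 ∧ (TOP i).2 ⊆ (BOT i).2 ∧ (TOP i).2 ⊆ (BOT i).1 ∧ (BOT i).2 ⊆ (TOP i).1) ∧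
      (∀ j : Fin k0, (PT0 j).2 ⊆ (PT0 j).1) ∧
      (∀ m : Fin k2, ((QA m).1 ⊆ (QB m).1 ∧ (QB m).2 ⊆ (QA m).2) ∧ ((QA m).1 ⊆ (QC m).1 ∧ (QC m).2 ⊆ (QA m).2) ∧
        ((QB m).1 ⊆ (QD m).1 ∧ (QD m).2 ⊆ (QB m).2) ∧ ((QC m).1 ⊆ (QD m).1 ∧ (QD m).2 ⊆ (QC m).2) ∧
        ((QD m).2 ⊆ (QA m).1 ∧ (QA m).2 ⊆ (QD m).1) ∧ ((QC m).2 ⊆ (QB m).1 ∧ (QB m).2 ⊆ (QC m).1)))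
    {K₁ K₂ : Set V → Set V → ℝ}
    (hK₁ : ∀ ⦃A A' B B' : Set V⦄, A ⊆ A' → B' ⊆ B → K₁ A B ≤ K₁ A' B') (hso₁ : ∀ A B, 0 ≤ K₁ A B + K₁ B A)
    (hK₂ : ∀ ⦃A A' B B' : Set V⦄, A ⊆ A' → B' ⊆ B → K₂ A B ≤ K₂ A' B') (hso₂ : ∀ A B, 0 ≤ K₂ A B + K₂ B A) :
    0 ≤ ∑ a ∈ D, K₁ (↑(π a).1) (↑(π a).2) * K₂ (↑(π a).1) (↑(π a).2) := by
  let Φ : Finset V × Finset V → ℝ := fun z => K₁ (↑z.1) (↑z.2) * K₂ (↑z.1) (↑z.2)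
  have hsummand : ∀ a ∈ D, K₁ (↑(π a).1) (↑(π a).2) * K₂ (↑(π a).1) (↑(π a).2) = Φ (π a) := fun a _ => rfl
  rw [Finset.sum_congr rfl hsummand, Cherry.sum_eq_sum_image_card D π Φ]
  have hcov : ∀ z ∈ D.image π, (L : ℝ) * ((D.filter fun a => π a = z).card : ℝ) =
      (((∑ i : Fin k1, W1 i * ((if BOT i = z then 1 else 0) + (if TOP i = z then 1 else 0))) +
        (∑ j : Fin k0, W0 j * (if PT0 j = z then 1 else 0)) +
        ∑ m : Fin k2, W2 m * ((if QA m = z then 1 else 0) + (if QB m = z then 1 else 0) + (if QC m = z then 1 else 0) +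
          (if QD m = z then 1 else 0)) : ℕ) : ℝ) := by
    intro z hz
    have h := Finset.filter_eq_empty_iff.1 hcover hz
    push Not at h
    exact_mod_cast h
  have hLr : (0 : ℝ) < (L : ℝ) := by exact_mod_cast hL
  -- it suffices to show the L-scaled sum is nonnegative
  suffices hmain : 0 ≤ ∑ z ∈ D.image π, ((L : ℝ) * ((D.filter fun a => π a = z).card : ℝ)) * Φ z by
    have hfac : ∑ z ∈ D.image π, ((L : ℝ) * ((D.filter fun a => π a = z).card : ℝ)) * Φ z =
        (L : ℝ) * ∑ z ∈ D.image π, ((D.filter fun a => π a = z).card : ℝ) * Φ z := by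
      rw [Finset.mul_sum]
      exact Finset.sum_congr rfl fun z _ => by ring
    rw [hfac] at hmain
    by_contra hneg
    push Not at hneg
    have : (L : ℝ) * ∑ z ∈ D.image π, ((D.filter fun a => π a = z).card : ℝ) * Φ z < 0 := mul_neg_of_pos_of_neg hLr hneg
    linarith
  rw [Finset.sum_congr rfl fun z hz => by rw [hcov z hz]]
  simp only [Nat.cast_add, Nat.cast_sum, Nat.cast_mul, Nat.cast_ite, Nat.cast_one, Nat.cast_zero, add_mul, Finset.sum_add_distrib,
    Finset.sum_mul]
  rw [Finset.sum_comm, Finset.sum_comm (s := D.image π), Finset.sum_comm (s := D.image π)]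
  refine add_nonneg (add_nonneg (Finset.sum_nonneg fun i _ => ?_) (Finset.sum_nonneg fun j _ => ?_)) (Finset.sum_nonneg fun m _ => ?_)
  · -- 1-cube `i`
    have e1 : ∑ z ∈ D.image π, (W1 i : ℝ) * ((if BOT i = z then (1 : ℝ) else 0) + (if TOP i = z then (1 : ℝ) else 0)) * Φ z =
        (W1 i : ℝ) * (Φ (BOT i) + Φ (TOP i)) := by
      rw [Finset.sum_congr rfl fun z _ => show (W1 i : ℝ) * ((if BOT i = z then (1 : ℝ) else 0) + (if TOP i = z then (1 : ℝ) else 0)) * Φ z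
          = (if BOT i = z then (W1 i : ℝ) else 0) * Φ z + (if TOP i = z then (W1 i : ℝ) else 0) * Φ z by
          split_ifs <;> ring]
      rw [Finset.sum_add_distrib, Cherry.sum_ite_point _ _ (hmem.1 i).1, Cherry.sum_ite_point _ _ (hmem.1 i).2]; ring
    rw [e1]
    refine mul_nonneg (Nat.cast_nonneg _) ?_
    obtain ⟨h1, h2, h3, h4⟩ := hok.1 i
    exact Cherry.one_cube_nonneg _ _ _ _ (Finset.coe_subset.2 h1) (Finset.coe_subset.2 h2) (Finset.coe_subset.2 h3)
      (Finset.coe_subset.2 h4) hK₁ hso₁ hK₂ hso₂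
  · -- 0-cube `j`
    have e0 : ∑ z ∈ D.image π, (W0 j : ℝ) * (if PT0 j = z then (1 : ℝ) else 0) * Φ z = (W0 j : ℝ) * Φ (PT0 j) := by
      rw [Finset.sum_congr rfl fun z _ => show (W0 j : ℝ) * (if PT0 j = z then (1 : ℝ) else 0) * Φ z
          = (if PT0 j = z then (W0 j : ℝ) else 0) * Φ z by split_ifs <;> ring]
      rw [Cherry.sum_ite_point _ _ (hmem.2.1 j)]
    rw [e0]
    exact mul_nonneg (Nat.cast_nonneg _) (Cherry.zero_cube_nonneg _ _ (Finset.coe_subset.2 (hok.2.1 j)) hK₁ hso₁ hK₂ hso₂)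
  · -- 2-cube `m`
    have e2 : ∑ z ∈ D.image π, (W2 m : ℝ) * ((if QA m = z then (1 : ℝ) else 0) + (if QB m = z then (1 : ℝ) else 0) +
        (if QC m = z then (1 : ℝ) else 0) + (if QD m = z then (1 : ℝ) else 0)) * Φ z =
        (W2 m : ℝ) * (Φ (QA m) + Φ (QB m) + Φ (QC m) + Φ (QD m)) := by
      rw [Finset.sum_congr rfl fun z _ => show (W2 m : ℝ) * ((if QA m = z then (1 : ℝ) else 0) + (if QB m = z then (1 : ℝ) else 0) +
          (if QC m = z then (1 : ℝ) else 0) + (if QD m = z then (1 : ℝ) else 0)) * Φ z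
          = (if QA m = z then (W2 m : ℝ) else 0) * Φ z + (if QB m = z then (W2 m : ℝ) else 0) * Φ z +
            ((if QC m = z then (W2 m : ℝ) else 0) * Φ z + (if QD m = z then (W2 m : ℝ) else 0) * Φ z) by
          split_ifs <;> ring]
      rw [Finset.sum_add_distrib, Finset.sum_add_distrib, Finset.sum_add_distrib, Cherry.sum_ite_point _ _ (hmem.2.2 m).1,
        Cherry.sum_ite_point _ _ (hmem.2.2 m).2.1, Cherry.sum_ite_point _ _ (hmem.2.2 m).2.2.1,
        Cherry.sum_ite_point _ _ (hmem.2.2 m).2.2.2]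
      ring
    rw [e2]
    refine mul_nonneg (Nat.cast_nonneg _) ?_
    obtain ⟨hab, hac, hbd, hcd, had, hbc⟩ := hok.2.2 m
    exact Cube.two_nonneg _ _ _ _ _ _ _ _ ⟨Finset.coe_subset.2 hab.1, Finset.coe_subset.2 hab.2⟩
      ⟨Finset.coe_subset.2 hac.1, Finset.coe_subset.2 hac.2⟩ ⟨Finset.coe_subset.2 hbd.1, Finset.coe_subset.2 hbd.2⟩
      ⟨Finset.coe_subset.2 hcd.1, Finset.coe_subset.2 hcd.2⟩ ⟨Finset.coe_subset.2 had.1, Finset.coe_subset.2 had.2⟩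
      ⟨Finset.coe_subset.2 hbc.1, Finset.coe_subset.2 hbc.2⟩ hK₁ hso₁ hK₂ hso₂

end Cert

end Antithetic

end Summit.CriticalPhenomena.PercolationContinuityZ3.Theorems
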